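import Literature.NumberTheory.LFunctions.Zhang2022.KnifeEdgeLenZDegreeShort
import Literature.NumberTheory.LFunctions.Zhang2022.Section4Prop22Eventually

/-!
# Zhang (2022), rung F-S3 (Landau–Siegel programme, §D edge len = E*-len⁺): route `ZDegreeToeplitzBand` —
# DENSITY REDUCTION for the darkness of a ψ-graded cross slot: dark on a sub-class `𝒞₀` + side tables (K0) + approximation
# in the `𝔅`-currency ⇒ dark on the whole class (`crossTablePsiOn_zero_of_dense`, `tauTwoDarkShort_of_dense`)

Y. Zhang, *Discrete mean estimates and the Landau–Siegel zero*, arXiv:2211.02515v1 [Zhang2022LandauSiegel] — an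
unrefereed manuscript under adjudication. **WHAT THIS IS NOT: not a claim about Theorems 1–2 of arXiv:2211.02515, about
Landau–Siegel zeros, or about Parity. The programme SEARCHES and TYPES; no claim about Landau–Siegel zeros, Theorems 1–2
of arXiv:2211.02515 or a repaired Margin232 until a kernel theorem says so.** `E₀`-free (no instance of
`KnifeEdge.PsiGradedClosedForms`); every OPEN input is a hypothesis — this file ELIMINATES NOTHING.

WHAT IS HERE. The §E «density extension» step of the K1″a hand's DISPLAY #2 (ls-knife-typer-1 g7,
`K1A-DISPLAY-2-dipole.md` v1.1 9270e546693b3568; vocabulary `KnifeEdgeLenZDegreeShort`, p516582), typed as the REDUCTION it is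
(ls-theory g4 review 09:17:21Z N4 and addendum 09:27:33Z E-1/E-2; ls-knife-crit-1 g6 (q)-read 09:26:11Z: «§E is a REDUCTION,
not an elimination — exactly as open as K0 on the rough class»):

* Part 1 — algebra of the graded mean `zDegMeanPsi` (`Σ Re𝔠*·Z(ρ,ψ)^d·F·Ḡ·Re ω`, which is `.re`-WEIGHTED BY DEFINITION, E-1):
  additivity/subtractivity in each table, the identity `zDegMeanPsi d F G = discPolar (Z^d·F) G`, and CAUCHY–SCHWARZ
  `‖zDegMeanPsi d F G‖² ≤ Ξ(F)·Ξ(G)` under `Re𝔠*·Re ω ≥ 0` and `|Z(ρ,ψ)| = 1` on the index set (the tree's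
  `norm_sq_discPolar_le` + `discMean_zfac_zpow_mul`); `profPoly_sub`.
* Part 2 — `crossTablePsiOn_zero_of_dense` (every degree `d`, every pair class `𝒞`): IF the slot of degree `d` is dark on the
  in-class pairs of a sub-class `𝒞₀` (OPEN input), the side tables `InClassMean c′` hold (K0 = stmt-Parity-20016, OPEN input)
  with Lemma 2.3 at `c′` (`Skeleton.Lemma23 c′`), AND every in-class pair of `𝒞` is approximated IN THE `𝔅`-CURRENCY by
  in-class pairs of `𝒞₀` (`𝔅(f − f_N), 𝔅(g − g_N) ≤ η` for every `η > 0`; an `H¹`-density of `𝒞₀` in `𝒞` with a bound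
  `𝔅(w) ≤ C_𝔅‖w‖²_{H¹}` gives this), THEN the slot is dark on `𝒞`. Proof: sesquilinear decomposition
  `τ_d(g,f) = τ_d(g_N,f_N) + τ_d(g,f−f_N) + τ_d(g−g_N,f) − τ_d(g−g_N,f−f_N)`, darkness on `𝒞₀` for the first term, Cauchy–Schwarz
  + K0 (`Ξ(H_w) ≤ (𝔅(w)+η)𝔞𝔓` eventually, `discMean_profPoly_le_of_inClassMean`) for the three corrections, with the weights'
  signs from Lemma 2.3 + Prop 2.2 (i) (`weights_nonneg_of`) and `|Z| = 1` from Prop 2.2 (i) (`norm_Zpsi_eq_one_of`,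
  `prop22i_holds` — a tree theorem), and the choice `η = min(1, ε/16, ε²/(128(max(𝔅f,𝔅g)+1)))`.
  `tauTwoDarkShort_of_dense` is the case `d = 2`, `𝒞 = ShortPairs` (`TauTwoDarkShort c′`); `…_eventually` discharges Lemma 2.3
  for all large `c′` by `lemma23_eventually`.

Typer: ls-knife-typer-3 g8 (RUNG OFFER of ls-knife-typer-1 g7 09:11:50Z/09:17:47Z, taken 09:46:44Z; cell landau-siegel §D).

## References
* Y. Zhang, arXiv:2211.02515v1 (2022), §2 Lemma 2.3, (2.15)–(2.17); §7 Prop. 7.1 (7.2); §8 (8.2), (8.5), Lemma 8.1,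
  Lemma 8.2, (8.23). [cite: Zhang2022LandauSiegel, §2 Lemma 2.3, (2.15)–(2.17), §7 Prop 7.1 (7.2), §8 (8.5), Lemma 8.1]
-/

noncomputable section

open Complex Real ComplexConjugate Finset

namespace Literature.NumberTheory.LFunctions.Zhang2022.KnifeEdge

open Repair Skeleton

/-! ### Part 1 — algebra of the graded mean: additivity in each table, reduction to the polar pairing, Cauchy–Schwarz -/

section Algebra

variable {c' : ℝ} {D : ℕ} {χ : DirichletCharacter ℂ D}

/-- The graded mean is additive in the FIRST table. [cite: Zhang2022LandauSiegel, §2 (2.16)–(2.17)] -/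
theorem zDegMeanPsi_add_left (d : ℤ) (F₁ F₂ G : Chr D → ℂ → ℂ) :
    zDegMeanPsi c' χ d (fun x t => F₁ x t + F₂ x t) G = zDegMeanPsi c' χ d F₁ G + zDegMeanPsi c' χ d F₂ G := by
  unfold zDegMeanPsi
  rw [← Finset.sum_add_distrib]
  exact Finset.sum_congr rfl fun i _ => by ring

/-- The graded mean is additive in the SECOND table. [cite: Zhang2022LandauSiegel, §2 (2.16)–(2.17)] -/
theorem zDegMeanPsi_add_right (d : ℤ) (F G₁ G₂ : Chr D → ℂ → ℂ) :
    zDegMeanPsi c' χ d F (fun x t => G₁ x t + G₂ x t) = zDegMeanPsi c' χ d F G₁ + zDegMeanPsi c' χ d F G₂ := by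
  unfold zDegMeanPsi
  rw [← Finset.sum_add_distrib]
  exact Finset.sum_congr rfl fun i _ => by simp only [map_add]; ring

/-- The graded mean is subtractive in the FIRST table. [cite: Zhang2022LandauSiegel, §2 (2.16)–(2.17)] -/
theorem zDegMeanPsi_sub_left (d : ℤ) (F₁ F₂ G : Chr D → ℂ → ℂ) :
    zDegMeanPsi c' χ d (fun x t => F₁ x t - F₂ x t) G = zDegMeanPsi c' χ d F₁ G - zDegMeanPsi c' χ d F₂ G := by
  unfold zDegMeanPsi
  rw [← Finset.sum_sub_distrib]
  exact Finset.sum_congr rfl fun i _ => by ring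

/-- The graded mean is subtractive in the SECOND table. [cite: Zhang2022LandauSiegel, §2 (2.16)–(2.17)] -/
theorem zDegMeanPsi_sub_right (d : ℤ) (F G₁ G₂ : Chr D → ℂ → ℂ) :
    zDegMeanPsi c' χ d F (fun x t => G₁ x t - G₂ x t) = zDegMeanPsi c' χ d F G₁ - zDegMeanPsi c' χ d F G₂ := by
  unfold zDegMeanPsi
  rw [← Finset.sum_sub_distrib]
  exact Finset.sum_congr rfl fun i _ => by simp only [map_sub]; ring

/-- The graded mean of degree `d` is the polar pairing of the `Z^d`-twisted first table with the second.
[cite: Zhang2022LandauSiegel, §2 (2.16)–(2.17), §8 (8.2)] -/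
theorem zDegMeanPsi_eq_discPolar (d : ℤ) (F G : Chr D → ℂ → ℂ) :
    zDegMeanPsi c' χ d F G = discPolar c' χ (fun x s => GammaFactor.Zfac x.ψ s ^ d * F x s) G := by
  unfold zDegMeanPsi discPolar
  refine Finset.sum_congr rfl fun i _ => ?_
  push_cast
  ring

/-- With `|Z(ρ,ψ)| = 1` on the index set, twisting a table by `Z^d` does not change its discrete mean.
[cite: Zhang2022LandauSiegel, §8 (8.2)] -/
theorem discMean_zfac_zpow_mul (hZ : ∀ i ∈ idx χ, ‖GammaFactor.Zfac i.1.ψ i.2‖ = 1) (d : ℤ) (F : Chr D → ℂ → ℂ) :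
    discMean c' χ (fun x s => GammaFactor.Zfac x.ψ s ^ d * F x s) = discMean c' χ F := by
  unfold discMean
  refine Finset.sum_congr rfl fun i hi => ?_
  rw [norm_mul, norm_zpow, hZ i hi, one_zpow, one_mul]

/-- **Cauchy–Schwarz for the graded mean** (every degree, every modulus; weights `Re 𝔠*·Re ω ≥ 0` and `|Z| = 1` on the
index set — Lemma 2.3, (2.15), Prop 2.2 (i)): `‖Σ Re𝔠*·Z^d·F·Ḡ·Re ω‖² ≤ Ξ(F)·Ξ(G)`.
[cite: Zhang2022LandauSiegel, §2 Lemma 2.3, (2.15)–(2.17)] -/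
theorem norm_sq_zDegMeanPsi_le (hw : ∀ i ∈ idx χ, 0 ≤ (cstar c' D i.1 i.2).re * (omegaW D i.2).re)
    (hZ : ∀ i ∈ idx χ, ‖GammaFactor.Zfac i.1.ψ i.2‖ = 1) (d : ℤ) (F G : Chr D → ℂ → ℂ) :
    ‖zDegMeanPsi c' χ d F G‖ ^ 2 ≤ discMean c' χ F * discMean c' χ G := by
  rw [zDegMeanPsi_eq_discPolar, ← discMean_zfac_zpow_mul hZ d F]
  exact norm_sq_discPolar_le hw _ G

/-- … in square-root form: `‖Σ Re𝔠*·Z^d·F·Ḡ·Re ω‖ ≤ √(Ξ(F)·Ξ(G))`. [cite: Zhang2022LandauSiegel, §2 Lemma 2.3, (2.15)–(2.17)] -/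
theorem norm_zDegMeanPsi_le_sqrt (hw : ∀ i ∈ idx χ, 0 ≤ (cstar c' D i.1 i.2).re * (omegaW D i.2).re)
    (hZ : ∀ i ∈ idx χ, ‖GammaFactor.Zfac i.1.ψ i.2‖ = 1) (d : ℤ) (F G : Chr D → ℂ → ℂ) :
    ‖zDegMeanPsi c' χ d F G‖ ≤ Real.sqrt (discMean c' χ F * discMean c' χ G) := by
  rw [← Real.sqrt_sq (norm_nonneg (zDegMeanPsi c' χ d F G))]
  exact Real.sqrt_le_sqrt (norm_sq_zDegMeanPsi_le hw hZ d F G)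

/-- `profPoly` is subtractive in the profile. [cite: Zhang2022LandauSiegel, §2 (2.23)–(2.25)] -/
theorem profPoly_sub (x : Chr D) (g₁ g₂ : ℝ → ℂ) (N : ℕ) (s : ℂ) :
    profPoly χ x (fun z => g₁ z - g₂ z) N s = profPoly χ x g₁ N s - profPoly χ x g₂ N s := by
  unfold profPoly
  rw [← Finset.sum_sub_distrib]
  exact Finset.sum_congr rfl fun n _ => by ring

end Algebra


/-! ### Part 2 — the DENSITY REDUCTION: darkness on a sub-class + K0 + approximation in the `𝔅`-currency ⇒ darkness -/

section Dense

variable {c' : ℝ}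

/-- **K0 as an upper bound:** under the side tables `InClassMean c′`, for a kinked profile `u` and `η > 0`, eventually under
(A): `Ξ(H_u) ≤ (𝔅(u) + η)·𝔞𝔓`. [cite: Zhang2022LandauSiegel, §7 Prop 7.1, §8 (8.23)] -/
theorem discMean_profPoly_le_of_inClassMean (hK0 : InClassMean c') {u u' : ℝ → ℂ} (hu : KinkedProfile u u')
    {η : ℝ} (hη : 0 < η) :
    ForAllLarge fun D _ χ => AssumptionA D χ →
      discMean c' χ (fun x t => profPoly χ x u (⌊bigP D⌋₊ + 1) t) ≤ (mainTermForm u u' + η) * (frakA χ * frakP D) := by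
  refine (hK0 u u' hu η hη).mono ?_
  intro D _ χ _ _ h hA
  have h1 := (abs_le.1 (h hA)).2
  calc discMean c' χ (fun x t => profPoly χ x u (⌊bigP D⌋₊ + 1) t)
      ≤ mainTermForm u u' * frakA χ * frakP D + η * frakA χ * frakP D := by linarith
    _ = (mainTermForm u u' + η) * (frakA χ * frakP D) := by ring

/-- The difference of two in-class pieces is an in-class piece. [cite: Zhang2022LandauSiegel, §7 Prop 7.1 (7.2)] -/
theorem InClassPiece.sub {f f' g g' : ℝ → ℂ} (hf : InClassPiece f f') (hg : InClassPiece g g') :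
    InClassPiece (fun x => f x - g x) (fun x => f' x - g' x) where
  kinked := by
    have h := hf.kinked.add_smul hg.kinked (-1)
    have e1 : (fun x => f x + (-1) * g x) = fun x => f x - g x := by funext x; ring
    have e2 : (fun x => f' x + (-1) * g' x) = fun x => f' x - g' x := by funext x; ring
    rw [e1, e2] at h
    exact h
  vanish := fun y hy => by simp [hf.vanish y hy, hg.vanish y hy]
  vanish' := fun y hy => by simp [hf.vanish' y hy, hg.vanish' y hy]

/-- **THE DENSITY REDUCTION (every degree `d`, every pair class `𝒞`).** Suppose: (i) the ψ-graded cross slot of degree `d`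
is DARK (zero functional) on the in-class pairs of a sub-class `𝒞₀` — an OPEN input, asserted by no one; (ii) the side
tables `InClassMean c′` (K0, stmt-Parity-20016 — OPEN input) and Lemma 2.3 at `c′` (`Skeleton.Lemma23 c′`, a CLAIM; for
all large `c′` a tree theorem, `lemma23_eventually`); (iii) APPROXIMATION IN THE `𝔅`-CURRENCY: every in-class pair of `𝒞`
is, for every `η > 0`, within `𝔅`-distance `η` (in each piece) of an in-class pair of `𝒞₀`. THEN the slot is dark on `𝒞`.
Proof: for a pair `(f,g) ∈ 𝒞` and `ε > 0` choose `η = η(ε, 𝔅(f), 𝔅(g))` and an approximant `(f_N,g_N) ∈ 𝒞₀` with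
`𝔅(f−f_N), 𝔅(g−g_N) ≤ η`; by sesquilinearity
`τ_d(g,f) = τ_d(g_N,f_N) + τ_d(g, f−f_N) + τ_d(g−g_N, f) − τ_d(g−g_N, f−f_N)`; the first term is `≤ (ε/2)𝔞𝔓` eventually by
(i); each correction is bounded by Cauchy–Schwarz (`norm_sq_zDegMeanPsi_le`, weights `≥ 0` by Lemma 2.3 + Prop 2.2 (i),
`|Z(ρ,ψ)| = 1` by Prop 2.2 (i) — `prop22i_holds`, in the tree) by `√(Ξ(H_·)Ξ(H_·))`, and K0 turns each `Ξ(H_w)` into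
`≤ (𝔅(w) + η)𝔞𝔓`; the choice of `η` makes the three corrections `≤ (3ε/8)𝔞𝔓`. This is the §E «density extension» step of
the K1″a hand's DISPLAY #2 (K1A-DISPLAY-2-dipole.md v1.1 9270e546693b3568), typed as the REDUCTION it is (ls-theory g4
09:17:21Z N4 / 09:27:33Z E-1–E-2; ls-knife-crit-1 g6 09:26:11Z): nothing is eliminated — darkness on `𝒞₀`, K0 and the
approximation property are hypotheses, the conclusion is exactly as open as they are. An `H¹`-density of `𝒞₀` in `𝒞` together
with a bound `𝔅(w) ≤ C_𝔅‖w‖²_{H¹}` gives (iii). [cite: Zhang2022LandauSiegel, §2 Lemma 2.3, (2.15)–(2.17), §7 Prop 7.1, §8 (8.5), Lemma 8.1] -/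
theorem crossTablePsiOn_zero_of_dense {𝒞 𝒞₀ : PairClass} {d : ℕ}
    (hdark : CrossTablePsiOn c' 𝒞₀ d (fun _ _ _ _ => 0)) (hK0 : InClassMean c') (h23 : Lemma23 c')
    (hdense : ∀ (f f' g g' : ℝ → ℂ), InClassPiece f f' → InClassPiece g g' → 𝒞 f f' g g' → ∀ η : ℝ, 0 < η →
      ∃ fN fN' gN gN' : ℝ → ℂ, InClassPiece fN fN' ∧ InClassPiece gN gN' ∧ 𝒞₀ fN fN' gN gN' ∧
        mainTermForm (fun x => f x - fN x) (fun x => f' x - fN' x) ≤ η ∧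
        mainTermForm (fun x => g x - gN x) (fun x => g' x - gN' x) ≤ η) :
    CrossTablePsiOn c' 𝒞 d (fun _ _ _ _ => 0) := by
  intro f f' g g' hf hg h𝒞 ε hε
  -- sizes of the two pieces in the 𝔅-currency
  set Bf := mainTermForm f f' with hBf
  set Bg := mainTermForm g g' with hBg
  have hBf0 : 0 ≤ Bf := mainTermForm_nonneg_of_isH1 hf.kinked.isH1
  have hBg0 : 0 ≤ Bg := mainTermForm_nonneg_of_isH1 hg.kinked.isH1
  set B := max Bf Bg with hB
  have hB0 : 0 ≤ B := le_max_of_le_left hBf0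
  have hB1 : 0 < B + 1 := by linarith
  -- the approximation scale
  set η : ℝ := min 1 (min (ε / 16) (ε ^ 2 / (128 * (B + 1)))) with hη
  have hη0 : 0 < η := lt_min zero_lt_one (lt_min (by positivity) (by positivity))
  have hη1 : η ≤ 1 := min_le_left _ _
  have hη16 : η ≤ ε / 16 := (min_le_right _ _).trans (min_le_left _ _)
  have hηsq : η ≤ ε ^ 2 / (128 * (B + 1)) := (min_le_right _ _).trans (min_le_right _ _)
  have h2η : η + η ≤ ε ^ 2 / (64 * (B + 1)) := by
    have : ε ^ 2 / (64 * (B + 1)) = 2 * (ε ^ 2 / (128 * (B + 1))) := by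
      field_simp
      ring
    rw [this]
    linarith
  have hkey : ∀ {Bu : ℝ}, Bu ≤ B → (Bu + η) * (η + η) ≤ (ε / 8) ^ 2 := by
    intro Bu hBu
    have h1 : Bu + η ≤ B + 1 := add_le_add hBu hη1
    calc (Bu + η) * (η + η) ≤ (B + 1) * (ε ^ 2 / (64 * (B + 1))) :=
          mul_le_mul h1 h2η (by positivity) (by positivity)
      _ = (ε / 8) ^ 2 := by
          field_simp
          ring
  -- the approximants and the differences
  obtain ⟨fN, fN', gN, gN', hfN, hgN, h𝒞₀, hBhf, hBhg⟩ := hdense f f' g g' hf hg h𝒞 η hη0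
  have hhf : InClassPiece (fun x => f x - fN x) (fun x => f' x - fN' x) := hf.sub hfN
  have hhg : InClassPiece (fun x => g x - gN x) (fun x => g' x - gN' x) := hg.sub hgN
  -- the eventual inputs
  have Edark := hdark fN fN' gN gN' hfN hgN h𝒞₀ (ε / 2) (by positivity)
  have Ef := discMean_profPoly_le_of_inClassMean hK0 hf.kinked hη0
  have Eg := discMean_profPoly_le_of_inClassMean hK0 hg.kinked hη0
  have Ehf := discMean_profPoly_le_of_inClassMean hK0 hhf.kinked hη0
  have Ehg := discMean_profPoly_le_of_inClassMean hK0 hhg.kinked hη0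
  have E3 : ForAllLarge fun D _ _ => 3 ≤ D := ForAllLarge.of_le 3 fun D _ _ hD _ _ => hD
  refine ((((((Edark.and Ef).and Eg).and Ehf).and Ehg).and (h23.and prop22i_holds)).and E3).mono ?_
  intro D _ χ _ _ hh hA
  obtain ⟨⟨⟨⟨⟨⟨hdk, hKf⟩, hKg⟩, hKhf⟩, hKhg⟩, ⟨h23D, h22D⟩⟩, hD3⟩ := hh
  -- weights and the unit on the index set
  have hw := weights_nonneg_of hD3 h23D h22D
  have hZ := norm_Zpsi_eq_one_of hD3 h22D
  -- abbreviations
  set N : ℕ := ⌊bigP D⌋₊ + 1 with hN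
  set A : ℝ := frakA χ * frakP D with hA'
  have hA0 : 0 ≤ A := mul_nonneg (frakA_nonneg χ) (frakP_nonneg D)
  set Hf : Chr D → ℂ → ℂ := fun x t => profPoly χ x f N t with hHf
  set Hg : Chr D → ℂ → ℂ := fun x t => profPoly χ x g N t with hHg
  set Hhf : Chr D → ℂ → ℂ := fun x t => profPoly χ x (fun z => f z - fN z) N t with hHhf
  set Hhg : Chr D → ℂ → ℂ := fun x t => profPoly χ x (fun z => g z - gN z) N t with hHhg
  set HfN : Chr D → ℂ → ℂ := fun x t => profPoly χ x fN N t with hHfN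
  set HgN : Chr D → ℂ → ℂ := fun x t => profPoly χ x gN N t with hHgN
  -- the four K0 bounds
  have dmf : discMean c' χ Hf ≤ (Bf + η) * A := hKf hA
  have dmg : discMean c' χ Hg ≤ (Bg + η) * A := hKg hA
  have dmhf : discMean c' χ Hhf ≤ (η + η) * A :=
    (hKhf hA).trans (mul_le_mul_of_nonneg_right (by linarith) hA0)
  have dmhg : discMean c' χ Hhg ≤ (η + η) * A :=
    (hKhg hA).trans (mul_le_mul_of_nonneg_right (by linarith) hA0)
  -- darkness of the approximant pair at ε/2
  have hdkN : ‖zDegMeanPsi c' χ d (fun x t => conj (HgN x t)) HfN‖ ≤ ε / 2 * A := by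
    have h := hdk hA
    simp only [zero_mul, sub_zero] at h
    rw [hA', ← mul_assoc]
    exact h
  -- the sesquilinear decomposition Φ(g,f) = Φ(gN,fN) + Φ(g,hf) + Φ(hg,f) − Φ(hg,hf)
  have e1 : HfN = fun x t => Hf x t - Hhf x t := by
    funext x t
    simp only [hHf, hHhf, hHfN, profPoly_sub]
    ring
  have e2 : (fun x t => conj (HgN x t)) = fun x t => conj (Hg x t) - conj (Hhg x t) := by
    funext x t
    simp only [hHg, hHhg, hHgN, profPoly_sub, map_sub]
    ring
  have hdecomp : zDegMeanPsi c' χ d (fun x t => conj (Hg x t)) Hf =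
      zDegMeanPsi c' χ d (fun x t => conj (HgN x t)) HfN + zDegMeanPsi c' χ d (fun x t => conj (Hg x t)) Hhf +
        zDegMeanPsi c' χ d (fun x t => conj (Hhg x t)) Hf - zDegMeanPsi c' χ d (fun x t => conj (Hhg x t)) Hhf := by
    rw [e2, e1, zDegMeanPsi_sub_left, zDegMeanPsi_sub_right, zDegMeanPsi_sub_right]
    ring
  -- Cauchy–Schwarz on the three corrections
  have c1 : ‖zDegMeanPsi c' χ d (fun x t => conj (Hg x t)) Hhf‖ ≤ Real.sqrt ((Bg + η) * A * ((η + η) * A)) := by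
    refine (norm_zDegMeanPsi_le_sqrt hw hZ _ _ _).trans (Real.sqrt_le_sqrt ?_)
    rw [discMean_conj]
    exact mul_le_mul dmg dmhf (discMean_nonneg hw _) (by positivity)
  have c2 : ‖zDegMeanPsi c' χ d (fun x t => conj (Hhg x t)) Hf‖ ≤ Real.sqrt ((η + η) * A * ((Bf + η) * A)) := by
    refine (norm_zDegMeanPsi_le_sqrt hw hZ _ _ _).trans (Real.sqrt_le_sqrt ?_)
    rw [discMean_conj]
    exact mul_le_mul dmhg dmf (discMean_nonneg hw _) (by positivity)
  have c3 : ‖zDegMeanPsi c' χ d (fun x t => conj (Hhg x t)) Hhf‖ ≤ Real.sqrt ((η + η) * A * ((η + η) * A)) := by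
    refine (norm_zDegMeanPsi_le_sqrt hw hZ _ _ _).trans (Real.sqrt_le_sqrt ?_)
    rw [discMean_conj]
    exact mul_le_mul dmhg dmhf (discMean_nonneg hw _) (by positivity)
  -- evaluate the square roots with the choice of η
  have s1 : Real.sqrt ((Bg + η) * A * ((η + η) * A)) ≤ ε / 8 * A := by
    have hle : (Bg + η) * A * ((η + η) * A) ≤ (ε / 8 * A) ^ 2 := by
      calc (Bg + η) * A * ((η + η) * A) = ((Bg + η) * (η + η)) * A ^ 2 := by ring
        _ ≤ (ε / 8) ^ 2 * A ^ 2 := mul_le_mul_of_nonneg_right (hkey (le_max_right _ _)) (sq_nonneg A)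
        _ = (ε / 8 * A) ^ 2 := by ring
    calc Real.sqrt ((Bg + η) * A * ((η + η) * A)) ≤ Real.sqrt ((ε / 8 * A) ^ 2) := Real.sqrt_le_sqrt hle
      _ = ε / 8 * A := Real.sqrt_sq (by positivity)
  have s2 : Real.sqrt ((η + η) * A * ((Bf + η) * A)) ≤ ε / 8 * A := by
    have hle : (η + η) * A * ((Bf + η) * A) ≤ (ε / 8 * A) ^ 2 := by
      calc (η + η) * A * ((Bf + η) * A) = ((Bf + η) * (η + η)) * A ^ 2 := by ring
        _ ≤ (ε / 8) ^ 2 * A ^ 2 := mul_le_mul_of_nonneg_right (hkey (le_max_left _ _)) (sq_nonneg A)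
        _ = (ε / 8 * A) ^ 2 := by ring
    calc Real.sqrt ((η + η) * A * ((Bf + η) * A)) ≤ Real.sqrt ((ε / 8 * A) ^ 2) := Real.sqrt_le_sqrt hle
      _ = ε / 8 * A := Real.sqrt_sq (by positivity)
  have s3 : Real.sqrt ((η + η) * A * ((η + η) * A)) ≤ ε / 8 * A := by
    rw [show (η + η) * A * ((η + η) * A) = ((η + η) * A) ^ 2 by ring,
      Real.sqrt_sq (by positivity)]
    exact mul_le_mul_of_nonneg_right (by linarith) hA0
  -- assemble
  have hgoal : ‖zDegMeanPsi c' χ d (fun x t => conj (Hg x t)) Hf‖ ≤ ε * A := by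
    rw [hdecomp]
    calc ‖zDegMeanPsi c' χ d (fun x t => conj (HgN x t)) HfN + zDegMeanPsi c' χ d (fun x t => conj (Hg x t)) Hhf +
            zDegMeanPsi c' χ d (fun x t => conj (Hhg x t)) Hf - zDegMeanPsi c' χ d (fun x t => conj (Hhg x t)) Hhf‖
        ≤ ‖zDegMeanPsi c' χ d (fun x t => conj (HgN x t)) HfN‖ + ‖zDegMeanPsi c' χ d (fun x t => conj (Hg x t)) Hhf‖ +
            ‖zDegMeanPsi c' χ d (fun x t => conj (Hhg x t)) Hf‖ + ‖zDegMeanPsi c' χ d (fun x t => conj (Hhg x t)) Hhf‖ :=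
          (norm_sub_le _ _).trans (by gcongr; exact (norm_add_le _ _).trans (by gcongr; exact norm_add_le _ _))
      _ ≤ ε / 2 * A + ε / 8 * A + ε / 8 * A + ε / 8 * A :=
          add_le_add (add_le_add (add_le_add hdkN (c1.trans s1)) (c2.trans s2)) (c3.trans s3)
      _ ≤ ε * A := by nlinarith [hA0, hε.le]
  simpa only [zero_mul, sub_zero, hA', mul_assoc] using hgoal

/-- **`tauTwoDarkShort_of_dense` — the K1″a §E rung (typed as a REDUCTION):** if the degree-2 ψ-graded table is dark on a
sub-class `𝒞₀` of in-class pairs (e.g. the piecewise-polynomial short pairs of DISPLAY #2's Lemma A — OPEN), the side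
tables K0 hold (`InClassMean c′`, stmt-Parity-20016 — OPEN) with Lemma 2.3 at `c′`, and every SHORT in-class pair
(`ShortPairs`: `θ_f + θ_g < 1`) is approximated in the `𝔅`-currency by pairs of `𝒞₀`, then `TauTwoDarkShort c′` (darkness on
ALL short pairs, p516582) holds. The three named inputs are hypotheses — this theorem eliminates nothing (crit-1 E-2: «§E is a
REDUCTION, not an elimination: exactly as open as K0-on-rough-H¹»); the sign data the Cauchy–Schwarz step needs (E-1: the
tree's `zDegMeanPsi` is `.re`-weighted) come from Lemma 2.3 (`h23`) and Prop 2.2 (i) (`prop22i_holds`, a tree theorem).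
[cite: Zhang2022LandauSiegel, §2 Lemma 2.3, (2.15)–(2.17), §7 Prop 7.1 (7.2), §8 (8.5), Lemma 8.1, Lemma 8.2] -/
theorem tauTwoDarkShort_of_dense {𝒞₀ : PairClass}
    (hdark : CrossTablePsiOn c' 𝒞₀ 2 (fun _ _ _ _ => 0)) (hK0 : InClassMean c') (h23 : Lemma23 c')
    (hdense : ∀ (f f' g g' : ℝ → ℂ), InClassPiece f f' → InClassPiece g g' → ShortPairs f f' g g' → ∀ η : ℝ, 0 < η →
      ∃ fN fN' gN gN' : ℝ → ℂ, InClassPiece fN fN' ∧ InClassPiece gN gN' ∧ 𝒞₀ fN fN' gN gN' ∧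
        mainTermForm (fun x => f x - fN x) (fun x => f' x - fN' x) ≤ η ∧
        mainTermForm (fun x => g x - gN x) (fun x => g' x - gN' x) ≤ η) :
    TauTwoDarkShort c' :=
  crossTablePsiOn_zero_of_dense hdark hK0 h23 hdense

/-- The same for all large `c′` with Lemma 2.3 DISCHARGED by the tree (`lemma23_eventually`): beyond a threshold `c₀`, darkness
on `𝒞₀` + K0 + `𝔅`-approximation ⇒ `TauTwoDarkShort c′`. [cite: Zhang2022LandauSiegel, §2 Lemma 2.3, §8 (8.5)] -/
theorem tauTwoDarkShort_of_dense_eventually :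
    ∃ c₀ : ℝ, 0 ≤ c₀ ∧ ∀ c' : ℝ, c₀ ≤ c' → ∀ {𝒞₀ : PairClass},
      CrossTablePsiOn c' 𝒞₀ 2 (fun _ _ _ _ => 0) → InClassMean c' →
      (∀ (f f' g g' : ℝ → ℂ), InClassPiece f f' → InClassPiece g g' → ShortPairs f f' g g' → ∀ η : ℝ, 0 < η →
        ∃ fN fN' gN gN' : ℝ → ℂ, InClassPiece fN fN' ∧ InClassPiece gN gN' ∧ 𝒞₀ fN fN' gN gN' ∧
          mainTermForm (fun x => f x - fN x) (fun x => f' x - fN' x) ≤ η ∧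
          mainTermForm (fun x => g x - gN x) (fun x => g' x - gN' x) ≤ η) →
      TauTwoDarkShort c' := by
  obtain ⟨c₀, h0, h⟩ := lemma23_eventually
  exact ⟨c₀, h0, fun c' hc' _ hdark hK0 hdense => tauTwoDarkShort_of_dense hdark hK0 (h c' hc') hdense⟩

end Dense

end Literature.NumberTheory.LFunctions.Zhang2022.KnifeEdge

end
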